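import Mathlib
import HarnessLib
import HarnessLib.Audit
import Summits.ValiantsHypothesis.Statement
import Literature.Computability.AlgebraicComplexity.DeterminantalComplexity
import Literature.Computability.AlgebraicComplexity.DeterminantalComplexityProofs
import Literature.Computability.AlgebraicComplexity.VPDeterminantalQPProofs
import Literature.Computability.AlgebraicComplexity.ValiantConjectureProofs
import HarnessLib.Audit.Status.Attr

/-!
Route: ContractivityPrice

# Route ContractivityPrice — price of contractivity — stable pencils re-realised with norm ≤ 1 at
quasi-polynomial cost, and contractive hardness of the stabilised permanent

X = K1 ∧ K2 ("it suffices to show X"), realising card contractive-realization-price at the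
ELEMENTARY stabilisation
Q_n(z) := per_n(I + z/(4n)) (zero-free on the closed polydisc of radius 2, Q_n(0) = 1; Barvinok's
per_n(J + 0.0975 z)/n! is the
interchangeable alternative). A CONTRACTIVE REALIZATION of size R of a polynomial p is p =
p(0)·det(I_R + diag(z_κ(1),…,z_κ(R))·K) with
‖K‖_op ≤ 1 (GKVW's det(I − K Z_n) up to Sylvester and sign); it certifies that p has no zero in the
open unit polydisc, and by
GrinshpanEtAl2015 Thm 3.1 every polynomial with no zero on the CLOSED polydisc has one, of
uncontrolled size.
K1 (PRICE OF CONTRACTIVITY): a polynomial in N variables with an affine determinantal representation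
of size m and no zero on the closed
polydisc of radius 2 has a contractive realization of size ≤ 2^((log₂(m+N)+d)^d), d absolute. K2
(CONTRACTIVE HARDNESS): the least size
of a contractive realization of Q_n is not quasi-polynomially bounded. Since dc(Q_n) = dc(per_n) and
Q_n is zero-free with margin 2,
K1 turns "dc(per_n) quasi-polynomial" (forced by per ∈ VP) into "cdc(Q_n) quasi-polynomial",
contradicting K2.
Lean: `(∃ d : ℕ, ∀ (N m : ℕ) {σ : Type} [Fintype σ] (p : MvPolynomial σ ℂ), Fintype.card σ ≤ N →
Literature.Computability.AlgebraicComplexity.HasDetRepr p m → (∀ z : σ → ℂ, (∀ j, ‖z j‖ ≤ 2) →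
MvPolynomial.eval z p ≠ 0) → ∃ R ≤ 2 ^ ((Nat.log 2 (m + N) + d) ^ d), ∃ (K : Matrix (Fin R) (Fin R)
ℂ) (κ : Fin R → σ), ‖Matrix.toEuclideanCLM (𝕜 := ℂ) K‖ ≤ 1 ∧ p = MvPolynomial.C (MvPolynomial.eval 0
p) * (1 + Matrix.diagonal (fun i => MvPolynomial.X (κ i)) * K.map (fun a : ℂ => (MvPolynomial.C a :
MvPolynomial σ ℂ))).det) ∧ (∀ c : ℕ, ∃ n : ℕ, ∀ R ≤ 2 ^ ((Nat.log 2 n + c) ^ c), ∀ (a : ℂ) (K :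
Matrix (Fin R) (Fin R) ℂ) (κ : Fin R → Fin n × Fin n), ‖Matrix.toEuclideanCLM (𝕜 := ℂ) K‖ ≤ 1 →
MvPolynomial.aeval (fun e : Fin n × Fin n => MvPolynomial.C (if e.1 = e.2 then (1 : ℂ) else 0) +
MvPolynomial.C ((4 * (n : ℂ))⁻¹) * MvPolynomial.X e)
(Literature.Computability.AlgebraicComplexity.perPoly (Fin n) ℂ) ≠ MvPolynomial.C a * (1 +
Matrix.diagonal (fun i => MvPolynomial.X (κ i)) * K.map (fun a : ℂ => (MvPolynomial.C a :
MvPolynomial (Fin n × Fin n) ℂ))).det)`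

## Assembly
Pure logic plus PROVED cone facts (sorry-free as `closes`/`assembly_holds` in the planner's
Sketch.lean, and rendered as the deciding
theorem): suppose per were a VP family; isQPBounded_determinantalComplexity_of_isVPFamily_holds
gives c with dc(per_n) ≤ 2^((log₂ n+c)^c);
PriceOfContractivity gives d, QpComposition gives c', ContractiveHardness at c' gives n;
hasDetRepr_determinantalComplexity_holds and
StabilisedPerDetRepr give a size-dc(per_n) representation of Q_n, StabilisedPerZeroFree the margin,
so PriceOfContractivity yields a
contractive realization of size ≤ 2^((log₂ n + c')^c') — contradiction. Hence per is not a VP family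
and
the hub bookkeeping of Theorems/HubHub.lean (inlined: mem_VP_ofFintype_iff_holds,
perFamily_mem_VNP_holds) gives VP ℂ ≠ VNP ℂ.
CdcSuperquadratic is the engine's first rung and is not used by the deciding theorem.

Rationale: WHY THIS LINE. Transplant from multivariable operator theory / robust control (dictionary on the
card): after the shift to a point where per does not
vanish, every determinantal expression is a state-space realization det(I − K Z), its size a state
dimension, "zero-free on the closed
polydisc" is μ_Δ(K) < 1 (GrinshpanKaliuzhnyiverbovetsWoerdeman2012 Rem 3.5) and "‖K‖ ≤ 1 after
re-realization" is FREE (noncommutative)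
robust stability μ̂ (BallGroenewaldTerhorst2014, PackardDoyle1993); the permanent provably ENJOYS
the licence (elementary zero-freeness of
per(I+W) for |W_ij| ≤ 1/(2n); Barvinok2015 for the J-centred version), and GrinshpanEtAl2015 Thm 3.1
/ GrinshpanEtAl2016 Thm 4.1 make a
contractive realization exist. The new complexity measure cdc (least contractive size) sits above
dc, so VP ≠ VNP splits into K1 — a
purely quantitative question about the commutative-vs-free stability gap (μ vs μ̂: equal only when
2s+f ≤ 3, gap unbounded, but always
repairable by enlarging the realization at unknown cost) that control theory poses only
qualitatively — and K2, a lower bound in a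
NORMED model where free boundedness caps every word coefficient of a noncommutative lift
(Nisan1991Noncommutative Hankel ranks; GKVW Thm
5.2/5.6 turn contractive realizations into Agler decompositions = Hermitian sums of squares of
bounded rank, Knese2011). Prior routes
never constrain the realization matrix by a norm: PrincipalMinorColouring uses the same Sylvester
normal form with algebraic relations
among principal minors, DetQP/GCTMult use hypersurface invariants and orbit closures; the negatives
index (Elusive candidate, Grenet
rigidity uniqueness) is untouched.

RANKED CRUXES. #2 PriceOfContractivity (crux) — (card K1, fixed margin 2, quasi-polynomial price)
there is d such that for all N, m and every polynomial p over ℂ in at most N variables admitting an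
affine determinantal representation of size m and having no zero on the closed polydisc of radius 2,
there are R ≤ 2^((log₂(m+N)+d)^d), K ∈ ℂ^{R×R} with operator norm ≤ 1 and a colouring κ : [R] →
variables with p = p(0)·det(I_R + diag(z∘κ)·K). [difficulty: open-problem] (why it might fail: Known
constructions (Hermitian Positivstellensatz + lurking contraction, GrinshpanEtAl2016 Thm 4.1; NC
lifting) give no size control; μ<μ̂ has unbounded gap for fixed K (PackardDoyle1993); a poly-size
stable pencil family with eventual-Agler order 2^Ω(N) (KVH-type, GKVW Ex 5.1) refutes it.)
[GrinshpanEtAl2015, GrinshpanEtAl2016, GrinshpanKaliuzhnyiverbovetsWoerdeman2012,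
BallGroenewaldTerhorst2014, PackardDoyle1993, arXiv:1503.06161, arXiv:1208.2288]
#3 ContractiveHardness (crux) — (card K2 at the elementary stabilisation) for every c there is n
such that for all R ≤ 2^((log₂ n + c)^c), all a ∈ ℂ, all K ∈ ℂ^{R×R} of operator norm ≤ 1 and all κ
: [R] → [n]², Q_n = per_n(I + z/(4n)) ≠ a·det(I_R + diag(z∘κ)·K): the contractive determinantal
complexity cdc(Q_n) is not quasi-polynomially bounded (finite by GrinshpanEtAl2015 Thm 3.1, ≥
dc(per_n) always). [difficulty: open-problem] (why it might fail: Implied by DetQP.DetqpThesis (cdc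
≥ dc; extended VH, BCS97 (21.41), open), so false if dc(per_n) = n^O(log n); the norm engines
(eventual-Agler order / Hermitian-SOS rank via GKVW Thm 5.2, Hankel rank of bounded NC lifts) have
never given a super-polynomial bound for an explicit stable family.)
[GrinshpanKaliuzhnyiverbovetsWoerdeman2012, Knese2011, Nisan1991Noncommutative,
BurgisserClausenShokrollahi1997, MignonRessayre2004, Grenet2011, arXiv:1008.4560]
#4 CdcSuperquadratic (crux) — first rung where the norm must work: there are ε > 0 and n₀ such that
for n ≥ n₀ every contractive realization Q_n = a·det(I_R + diag(z∘κ)·K), ‖K‖_op ≤ 1, has R ≥ n^(2+ε)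
(trivially R ≥ n²; via PrincipalMinorColouring.NormalForm and IkenmeyerLandsberg2017 R ≥ n²+1;
implied by PrincipalMinorColouring.TotalRankSuperlinear and by DetQP.DetqpSuperquadratic, weaker
than both). [difficulty: L] (why it might fail: cdc(Q_n) = O(n²) contradicts nothing known
(dc(per_n) ≥ n²/2 is the record, MignonRessayre2004); contractive read-O(1) realizations of
quadratic size are excluded by no argument, and NC-Nehari / Agler-rank duals are untested at this
scale.) [MignonRessayre2004, IkenmeyerLandsberg2017, Grenet2011,
GrinshpanKaliuzhnyiverbovetsWoerdeman2012, Nisan1991Noncommutative]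
#9 StabilisedPerZeroFree (support) — the licence (provable now): Q_n = per_n(I + z/(4n)) has no zero
on the closed polydisc of radius 2 — per(I+W) = Σ_T per(W[T]) over subsets T, and for |W_ij| ≤
1/(2n): |per(I+W) − 1| ≤ Σ_{k≥1} C(n,k)·k!·(2n)^(−k) ≤ Σ_{k≥1} 2^(−k) < 1. [difficulty:
provable-now] [Barvinok2016, Barvinok2015, Mathlib Matrix.permanent]
#9 StabilisedPerDetRepr (support) — substitution glue (provable now): an affine determinantal
representation of per_n of size m gives one of Q_n of the same size (apply the algebra map x_e ↦ δ_e
+ z_e/(4n) entrywise; affine entries stay affine, det commutes with ring maps); hence dc(Q_n) ≤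
dc(per_n). [difficulty: provable-now] [MignonRessayre2004, Mathlib RingHom.map_det]
#9 QpComposition (support) — arithmetic glue (provable now): quasi-polynomial bounds are closed
under the price bound — for all c, d there is c' with 2^((log₂(m+N)+d)^d) ≤ 2^((log₂ n + c')^c')
whenever m ≤ 2^((log₂ n + c)^c) and N ≤ n². [difficulty: provable-now] [Burgisser2000]

TWO-LAYER PLAN. Foreseen glued splits (k ≤ 3, depth 1), filed only when a crux closes or stalls with
a census:
ContractiveHardness ⇐ FreeLiftNormalForm (cdc(p) = min Σ_j rank H_j(R) over noncommutative rational
lifts R of 1/p bounded by 1 on all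
tuples of strict row contractions, H_j the Ball–Groenewald–Malakorn structured Hankel matrices; card
K3) → BoundedLiftRank (every such
bounded lift of 1/Q_n has super-quasi-polynomial Hankel rank; nuclear-norm dual certificates W_ω
seeing only the commutative Taylor data)
→ ContractiveHardness; alternative certificate child AglerRankHardness (no PSD-kernel solution of
the GKVW Thm 5.2 hereditary identity
for Q_n with Σ_j rank Γ_j quasi-polynomial; sandwiched between eventual-Agler ORDER and RANK by Thm
5.2/5.6).
PriceOfContractivity ⇐ ScalingCase (representations whose balanced factor K₀ already has ‖K₀‖ ≤
poly: free) → ReRealization (a pencil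
of size m zero-free with margin 2 admits an Agler-norm bound ‖c/p‖_A ≤ 1 with a transfer-function
realization of order qp(m,N):
quantitative GrinshpanEtAl2016 Thm 4.1 / lurking-contraction degree) → PriceOfContractivity.
CdcSuperquadratic ⇐ DetSanity (det_n(I + z/(4n)) HAS a contractive realization of size n²,
read-once: the model separates per from det
only through the norm) → PolarisationFloor → CdcSuperquadratic.

KILL CRITERIA. An explicit family of pencils of size poly(N), zero-free on the radius-2 polydisc,
all of whose contractive realizations need size
2^(N^δ) (e.g. amplified Kaijser–Varopoulos–Holbrook / GKVW Ex 5.1 polynomials, Treil-type μ-gap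
pencils) refutes PriceOfContractivity:
close `refuted:PriceOfContractivity` unless the witness lives exactly at margin 2 and becomes cheap
at larger margin, in which case
repair by the margin dial (NEW items: K1 at zero-free radius ρ(m,N) with the matching K2 for per_n(I
+ z/(2nρ)), i.e. norm budget
2nρ in the Sylvester normal form of per_n(I+z) — never a reworded item). A contractive realization
of Q_n of quasi-polynomial
size refutes ContractiveHardness and with it DetQP.DetqpThesis and PrincipalMinorColouring (extended
VH false at ℂ): close
`refuted:ContractiveHardness`. dc(per_n) ≤ 2^polylog proved anywhere kills the route the same way.
DetqpThesis proved elsewhere makes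
ContractiveHardness a corollary and moots the route (VH already follows); CdcSuperquadratic refuted
(contractive realizations of Q_n of
size O(n²)) kills only the first rung's optimism, not the assembly, but would make K2 implausible
enough to go dormant.

NOT DECOMPOSED YET. The free-lift / Agler-decomposition normal form (card K3) and its definitions
(NC lift of a layered ABP, free gain, structured Hankel
matrices, Schur–Agler class, eventual Agler denominator) — layer-2 children of ContractiveHardness,
filed when D1 lands or a prover
stalls with a census; the determinant sanity statement (det_n(I+z/(4n)) is contractively read-once,
and the Mahajan–Vinay clow lift has
free gain ≈ 2^n/3 numerically, card P5/K0) rides as `--supports CdcSuperquadratic`; the margin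
schedule (fixed ratio 2 here; the card's
δ(n) ≥ 1/poly variants) and the multiplier version p·q = det(I − KZ) of GrinshpanEtAl2016 are
alternative statements for a repair, not
items; the Barvinok-centred stabilisation per_n(J + 0.0975 z)/n! (Barvinok2015 Thm 1.1) is
interchangeable with Q_n and deliberately
not filed twice.

CHEAPEST FALSIFIER. Literature/kit check on PriceOfContractivity at fixed margin: take q_r from GKVW
Ex 5.1 (stable, not an Agler denominator at its degree)
and its disjoint-variable products / compositions; compute the least order n at which q_r(2·)⁻¹-type
data admit a contractive
realization (an SDP feasibility problem in the Gram matrices of the GKVW Thm 5.2 identity, sizes ≤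
30) and watch whether the order
grows multiplicatively under composition — exponential growth in a poly-size family kills K1. Lookup
done by the card (zbMATH
'structured singular value gap', 'minimal realizations Schur-Agler', GKVW Rem 3.9/5.10, Knese2011
Q1.4): no quantitative lower bound on
contractive realization size exists in print for ANY stable family — nothing to cite against K1 yet,
and nothing for it.

NUMBERS. dc window n²/2 ≤ dc(per_n) ≤ 2^n − 1 (MignonRessayre2004, Grenet2011); cdc(Q_n) ≥ dc(per_n)
and ≥ n² (every variable occurs), ≥ n²+1
via IkenmeyerLandsberg2017; det_n(I + z/(4n)) = det(I − K Z₁) with ‖K‖ = 1/4, size n² (card P2). One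
and two variables: price zero
(size = degree / bidegree, Kummert, GrinshpanEtAl2015 §1); fixed-realization scaling exact iff 2s+f
≤ 3 (PackardDoyle1993). Card
computations (P5): P_3 is an Agler denominator at minimal order (residual 8e-15); n = 2 read-once
contractive realizations attain the
GKVW floor 1/s(p); Mahajan–Vinay lift of det_n has free gain 1, 3.00, 6.04, 11.42, 21.98, 43.10,
84.97 for n = 2..8. Zero-free margin of
Q_n: |Q_n(z) − 1| ≤ 1 − 2^(−n) on the closed radius-2 polydisc. Items at open: 7 (3 cruxes, 3
supports, 1 assembly).

DEFINITION REQUESTS. - D1 `HasContractiveDetRepr (f : MvPolynomial σ ℂ) (R : ℕ)` /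
`contractiveDetComplexity f` (cdc; topic Literature/Analysis/OperatorTheory,
GrinshpanKaliuzhnyiverbovetsWoerdeman2012 (1.4)/(2.1)): ∃ K : Matrix (Fin R) (Fin R) ℂ, ∃ κ : Fin R
→ σ, ‖Matrix.toEuclideanCLM K‖ ≤ 1 ∧
f = C (eval 0 f) * det (1 + diagonal (X ∘ κ) * K.map C); cdc = sInf. The items inline this;
restating over D1 changes no meaning.
- D2 (later, layer 2) `IsSchurAgler` / `IsEventualAglerDenominator p n` (Knese2011 Def 1.3, GKVW §1)
and the NC-lift objects of card K3.
- cite facts wanted: GrinshpanEtAl2015 Thm 3.1 (strongly stable irreducible p, p(0)=1 ⇒ strictly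
contractive realization exists);
GrinshpanKaliuzhnyiverbovetsWoerdeman2012 Thm 5.2 (contractive realization of order n ⇒ eventual
Agler denominator of order n) and
Thm 5.6 (partial converse); Barvinok2015 Thm 1.1 (per(J+W) ≠ 0 for max|W_ij| ≤ δ₀).

Novelty: Searches (2026-08-15, this seat): grep 'contractiv|agler|structured singular|polydis|barvinok' over
all 47 Theses/*.lean of the summit
(3 incidental hits, no route); `lit frontier ValiantsHypothesis --since 2021` (30 rows; nearest
doi:10.1016/j.tcs.2026.115862 dc of
generalized permanents, nothing normed); `lit bridges ValiantsHypothesis --cross any` (30 rows, none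
operator-theoretic); `lit galaxy
search "contractive determinantal representation" --star all` (panama 0; pdf/crabby queue timeout);
local `lit search` ×5 — searchd unavailable (rc 75); remote
`lit search --source arxiv|zbmath` (10 queries): 'contractive determinantal representation stable
polynomial' (arXiv 3: 1503.06161,
1501.05527, 1306.6655; zbMATH 2), 'Agler denominator' (arXiv 3 / zbMATH 4: Knese2011,
arXiv:1208.2288, arXiv:1505.05437,
arXiv:1907.13191 Knese 'Kummert's approach to realization on the bidisk' = 2-variable dimension
counts), 'permanent Schur-Agler class'
(0/0), 'eventual Agler denominator degree bound' (0/0), 'minimal contractive determinantal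
representation size three variables' (0/0),
'structured singular value diagonal scaling gap realization dimension' (0/0), 'determinantal
representation permanent stable' (0/0);
OpenAlex 429; `lit read arXiv:1503.06161` (Thm 3.1 p.8, Cor p.9) and `lit read
arXiv:1208.2288` (Rem 3.5, 3.9, Ex 5.1, Thm 5.2, 5.6, Rem 5.10) page-checked. Card's own searches
(zbMATH ×7, galaxy ×3) found no
quantitative theory of contractive realization size.
Nearest prior art fou  [refs: 10.1016/j.tcs.2026.115862, 10.1145/3373207.3404010, 1208.2288, 1505.05437, 1907.13191, 1503.06161, doi:10.1016/j.tcs.2026.115862, doi:10.1145/3373207.3404010, Knese2011, GrinshpanKaliuzhnyiverbovetsWoerdeman2012, GrinshpanEtAl2015, Barvinok2015]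

Barriers (technique_class: contractive-realization, schur-agler-rank, nc-free-lift): - technique_class: contractive-realization, schur-agler-rank, nc-free-lift
- Literature.Barriers.ValiantsHypothesis.MonotoneGap: does not apply — K carries signs and phases;
the barrier's own witness (spanning trees / det) is contractively read-once (card P2), so the model
is not monotone.
- Literature.Barriers.ValiantsHypothesis.AlgebraicNaturalProofs: evaded in form — a
ContractiveHardness certificate is a semi-algebraic INEQUALITY (no PSD kernels of given ranks; a
nuclear-norm dual exceeding a bound) on a sub-model reached through PriceOfContractivity, not a
polynomial vanishing on VP's coefficient vectors; honest caveat: an Agler-rank bound could a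
posteriori be phrased through minors; the bet is that PSD-ness keeps certificates outside poly-size
algebraic distinguishers.
- Literature.Barriers.ValiantsHypothesis.RankMethods: not engaged — cdc is a minimum over similarity
orbits and free lifts under a norm constraint, not a sub-additive rank of a linear image of f; same
for RankLiftingBarrier.
- Literature.Barriers.ValiantsHypothesis.PartialDerivativesDetPerm: evaded and used as a design
constraint — det_n(I+z/(4n)) is contractively read-once (size n²), so any proof of CdcSuperquadratic
must separate per_n from det_n at equal n through the norm, never through flattening ranks.
- Literature.Barriers.ValiantsHypothesis.NoncommutativeExtensions: opposite direction —
Hrubeš–Yehudayoff make f easy over a huge noncommutative COEFFICIENT ring; here coefficients stay in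
ℂ and VARI

sub-problem: ValiantsHypothesis · status: draft · opened planner-plancard-ValiantsHypothesis-ValiantsH-9bd85154-0 2026-08-15T16:18:52Z · rev 1 · ledger route-ValiantsHypothesis-ContractivityPrice
GENERATED by the gate from the ledger (D-0016/17). Provers cite these decls: `theorem foo : Summit.ValiantsHypothesis.ValiantsHypothesis.Theses.ContractivityPrice.<Decl> := …` in Summits/ValiantsHypothesis/ValiantsHypothesis/Theorems/<Name>.lean.
-/

namespace Summit.ValiantsHypothesis.ValiantsHypothesis.Theses.ContractivityPrice

open scoped BigOperators Topology Manifold Classical MeasureTheory ProbabilityTheory Matrix InnerProductSpace ComplexConjugate ContinuousMap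
open Filter Set Function TopologicalSpace MeasureTheory

attribute [summit_statement] _root_.ValiantsHypothesis

open Literature.PNP

/-- item stmt-ValiantsHypothesis-10583 · crux · rank 2 · open · by planner
why it might fail: Known constructions (Hermitian Positivstellensatz + lurking contraction, GrinshpanEtAl2016 Thm 4.1; NC lifting) give no size control; μ<μ̂ has unbounded gap for fixed K (PackardDoyle1993); a poly-size stable pencil family with eventual-Agler order 2^Ω(N) (KVH-type, GKVW Ex 5.1) refutes it.
sources: GrinshpanEtAl2015, GrinshpanEtAl2016, GrinshpanKaliuzhnyiverbovetsWoerdeman2012, BallGroenewaldTerhorst2014, PackardDoyle1993, arXiv:1503.06161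
[crux] (card K1, fixed margin 2, quasi-polynomial price) there is d such that for all N, m and every
polynomial p over ℂ in at most N variables admitting an affine determinantal representation of size
m and having no zero on the closed polydisc of radius 2, there are R ≤ 2^((log₂(m+N)+d)^d), K ∈
ℂ^{R×R} with operator norm ≤ 1 and a colouring κ : [R] → variables with p = p(0)·det(I_R +
diag(z∘κ)·K). [difficulty: open-problem] -/
@[route_item "route-ValiantsHypothesis-ContractivityPrice", crux]
def PriceOfContractivity : Prop :=
  ∃ d : ℕ, ∀ (N m : ℕ) {σ : Type} [Fintype σ] (p : MvPolynomial σ ℂ), Fintype.card σ ≤ N → Literature.Computability.AlgebraicComplexity.HasDetRepr p m → (∀ z : σ → ℂ, (∀ j, ‖z j‖ ≤ 2) → MvPolynomial.eval z p ≠ 0) → ∃ R ≤ 2 ^ ((Nat.log 2 (m + N) + d) ^ d), ∃ (K : Matrix (Fin R) (Fin R) ℂ) (κ : Fin R → σ), ‖Matrix.toEuclideanCLM (𝕜 := ℂ) K‖ ≤ 1 ∧ p = MvPolynomial.C (MvPolynomial.eval 0 p) * (1 + Matrix.diagonal (fun i => MvPolynomial.X (κ i)) * K.map (fun a : ℂ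 => (MvPolynomial.C a : MvPolynomial σ ℂ))).det

/-- item stmt-ValiantsHypothesis-10584 · crux · rank 3 · open · by planner
why it might fail: Implied by DetQP.DetqpThesis (cdc ≥ dc; extended VH, BCS97 (21.41), open), so false if dc(per_n) = n^O(log n); the norm engines (eventual-Agler order / Hermitian-SOS rank via GKVW Thm 5.2, Hankel rank of bounded NC lifts) have never given a super-polynomial bound for an explicit stable family.
sources: GrinshpanKaliuzhnyiverbovetsWoerdeman2012, Knese2011, Nisan1991Noncommutative, BurgisserClausenShokrollahi1997, MignonRessayre2004, Grenet2011
[crux] (card K2 at the elementary stabilisation) for every c there is n such that for all R ≤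
2^((log₂ n + c)^c), all a ∈ ℂ, all K ∈ ℂ^{R×R} of operator norm ≤ 1 and all κ : [R] → [n]², Q_n =
per_n(I + z/(4n)) ≠ a·det(I_R + diag(z∘κ)·K): the contractive determinantal complexity cdc(Q_n) is
not quasi-polynomially bounded (finite by GrinshpanEtAl2015 Thm 3.1, ≥ dc(per_n) always).
[difficulty: open-problem] -/
@[route_item "route-ValiantsHypothesis-ContractivityPrice", crux]
def ContractiveHardness : Prop :=
  ∀ c : ℕ, ∃ n : ℕ, ∀ R ≤ 2 ^ ((Nat.log 2 n + c) ^ c), ∀ (a : ℂ) (K : Matrix (Fin R) (Fin R) ℂ) (κ : Fin R → Fin n × Fin n), ‖Matrix.toEuclideanCLM (𝕜 := ℂ) K‖ ≤ 1 → MvPolynomial.aeval (fun e : Fin n × Fin n => MvPolynomial.C (if e.1 = e.2 then (1 : ℂ) else 0) + MvPolynomial.C ((4 * (n : ℂ))⁻¹) * MvPolynomial.X e) (Literature.Computability.AlgebraicComplexity.perPoly (Fin n) ℂ) ≠ MvPolynomial.C a * (1 + Matrix.diagonal (fun i => MvPolynomial.X (κ i)) * K.map (fun a : ℂ => (MvPolynomial.C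 a : MvPolynomial (Fin n × Fin n) ℂ))).det

/-- item stmt-ValiantsHypothesis-10585 · crux · rank 4 · closed · proved by Summit.ValiantsHypothesis.ValiantsHypothesis.Theorems.ContractivityPrice.cdcSuperquadratic_proof (prover) · by planner
why it might fail: cdc(Q_n) = O(n²) contradicts nothing known (dc(per_n) ≥ n²/2 is the record, MignonRessayre2004); contractive read-O(1) realizations of quadratic size are excluded by no argument, and NC-Nehari / Agler-rank duals are untested at this scale.
sources: MignonRessayre2004, IkenmeyerLandsberg2017, Grenet2011, GrinshpanKaliuzhnyiverbovetsWoerdeman2012, Nisan1991Noncommutative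
[crux] first rung where the norm must work: there are ε > 0 and n₀ such that for n ≥ n₀ every
contractive realization Q_n = a·det(I_R + diag(z∘κ)·K), ‖K‖_op ≤ 1, has R ≥ n^(2+ε) (trivially R ≥
n²; via PrincipalMinorColouring.NormalForm and IkenmeyerLandsberg2017 R ≥ n²+1; implied by
PrincipalMinorColouring.TotalRankSuperlinear and by DetQP.DetqpSuperquadratic, weaker than both).
[difficulty: L] -/
@[route_item "route-ValiantsHypothesis-ContractivityPrice"]
def CdcSuperquadratic : Prop :=
  ∃ ε : ℝ, 0 < ε ∧ ∃ n₀ : ℕ, ∀ n ≥ n₀, ∀ (R : ℕ) (a : ℂ) (K : Matrix (Fin R) (Fin R) ℂ) (κ : Fin R → Fin n × Fin n), ‖Matrix.toEuclideanCLM (𝕜 := ℂ) K‖ ≤ 1 → MvPolynomial.aeval (fun e : Fin n × Fin n => MvPolynomial.C (if e.1 = e.2 then (1 : ℂ) else 0) + MvPolynomial.C ((4 * (n : ℂ))⁻¹) * MvPolynomial.X e) (Literature.Computability.AlgebraicComplexity.perPoly (Fin n) ℂ) = MvPolynomial.C a * (1 + Matrix.diagonal (fun i => MvPolynomial.X (κ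 i)) * K.map (fun a : ℂ => (MvPolynomial.C a : MvPolynomial (Fin n × Fin n) ℂ))).det → (n : ℝ) ^ (2 + ε) ≤ R

-- `CdcSuperquadratic` holds: proved by `Summit.ValiantsHypothesis.ValiantsHypothesis.Theorems.ContractivityPrice.cdcSuperquadratic_proof` (its module imports this route file, so no `_holds` link can be stated here).

/-- item stmt-ValiantsHypothesis-10586 · support · rank 9 · closed · proved by Summit.ValiantsHypothesis.ValiantsHypothesis.Theorems.stabilisedPerZeroFree_proof @ 01abd5044f03 (prover) · by planner
sources: Barvinok2016, Barvinok2015, Mathlib Matrix.permanent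
[support] the licence (provable now): Q_n = per_n(I + z/(4n)) has no zero on the closed polydisc of
radius 2 — per(I+W) = Σ_T per(W[T]) over subsets T, and for |W_ij| ≤ 1/(2n): |per(I+W) − 1| ≤
Σ_{k≥1} C(n,k)·k!·(2n)^(−k) ≤ Σ_{k≥1} 2^(−k) < 1. [difficulty: provable-now] -/
@[route_item "route-ValiantsHypothesis-ContractivityPrice", crux]
def StabilisedPerZeroFree : Prop :=
  ∀ (n : ℕ) (z : Fin n × Fin n → ℂ), (∀ e, ‖z e‖ ≤ 2) → MvPolynomial.eval z (MvPolynomial.aeval (fun e : Fin n × Fin n => MvPolynomial.C (if e.1 = e.2 then (1 : ℂ) else 0) + MvPolynomial.C ((4 * (n : ℂ))⁻¹) * MvPolynomial.X e) (Literature.Computability.AlgebraicComplexity.perPoly (Fin n) ℂ)) ≠ 0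

-- `StabilisedPerZeroFree` holds: proved by `Summit.ValiantsHypothesis.ValiantsHypothesis.Theorems.stabilisedPerZeroFree_proof` @ 01abd5044f03 (its module imports this route file, so no `_holds` link can be stated here).

/-- item stmt-ValiantsHypothesis-10587 · support · rank 9 · closed · proved by Summit.ValiantsHypothesis.Theorems.stabilisedPerDetRepr_proof @ 467a7d5b45f3 (prover) · by planner
sources: MignonRessayre2004, Mathlib RingHom.map_det
[support] substitution glue (provable now): an affine determinantal representation of per_n of size
m gives one of Q_n of the same size (apply the algebra map x_e ↦ δ_e + z_e/(4n) entrywise; affine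
entries stay affine, det commutes with ring maps); hence dc(Q_n) ≤ dc(per_n). [difficulty:
provable-now] -/
@[route_item "route-ValiantsHypothesis-ContractivityPrice", crux]
def StabilisedPerDetRepr : Prop :=
  ∀ (n m : ℕ), Literature.Computability.AlgebraicComplexity.HasDetRepr (Literature.Computability.AlgebraicComplexity.perPoly (Fin n) ℂ) m → Literature.Computability.AlgebraicComplexity.HasDetRepr (MvPolynomial.aeval (fun e : Fin n × Fin n => MvPolynomial.C (if e.1 = e.2 then (1 : ℂ) else 0) + MvPolynomial.C ((4 * (n : ℂ))⁻¹) * MvPolynomial.X e) (Literature.Computability.AlgebraicComplexity.perPoly (Fin n) ℂ)) m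

-- `StabilisedPerDetRepr` holds: proved by `Summit.ValiantsHypothesis.Theorems.stabilisedPerDetRepr_proof` @ 467a7d5b45f3 (its module imports this route file, so no `_holds` link can be stated here).

/-- item stmt-ValiantsHypothesis-10588 · support · rank 9 · closed · proved by Summit.ValiantsHypothesis.ValiantsHypothesis.Theorems.qpComposition_proof @ bd6db7cf03d5 (prover) · by planner
sources: Burgisser2000
[support] arithmetic glue (provable now): quasi-polynomial bounds are closed under the price bound —
for all c, d there is c' with 2^((log₂(m+N)+d)^d) ≤ 2^((log₂ n + c')^c') whenever m ≤ 2^((log₂ n +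
c)^c) and N ≤ n². [difficulty: provable-now] -/
@[route_item "route-ValiantsHypothesis-ContractivityPrice", crux]
def QpComposition : Prop :=
  ∀ c d : ℕ, ∃ c' : ℕ, ∀ n m N : ℕ, m ≤ 2 ^ ((Nat.log 2 n + c) ^ c) → N ≤ n ^ 2 → 2 ^ ((Nat.log 2 (m + N) + d) ^ d) ≤ 2 ^ ((Nat.log 2 n + c') ^ c')

-- `QpComposition` holds: proved by `Summit.ValiantsHypothesis.ValiantsHypothesis.Theorems.qpComposition_proof` @ bd6db7cf03d5 (its module imports this route file, so no `_holds` link can be stated here).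

/-- item stmt-ValiantsHypothesis-10589 · assembly · rank 1 · closed · proved by Summit.ValiantsHypothesis.Theorems.ContractivityPrice.Assembly_proof @ df3faa7aaeed (prover) · by planner
sources: BurgisserClausenShokrollahi1997, Burgisser2000, Valiant1979
[assembly] PriceOfContractivity → ContractiveHardness → StabilisedPerZeroFree → StabilisedPerDetRepr
→ QpComposition → ValiantsHypothesis (provable now; proof = the deciding theorem). -/
@[route_item "route-ValiantsHypothesis-ContractivityPrice"]
def Assembly : Prop :=
  PriceOfContractivity → ContractiveHardness → StabilisedPerZeroFree → StabilisedPerDetRepr → QpComposition → ValiantsHypothesis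

-- `Assembly` holds: proved by `Summit.ValiantsHypothesis.Theorems.ContractivityPrice.Assembly_proof` @ df3faa7aaeed (its module imports this route file, so no `_holds` link can be stated here).

/-! D-0027 §2.1 — DECIDING THEOREM (planner-authored via `route open/edit --closes-file`; by planner-plancard-ValiantsHypothesis-ValiantsH-9bd85154-0 2026-08-15T16:18:53Z):
its hypotheses are this route's items and its conclusion the sub-problem Statement (glue_lint), and it elaborates with this file. -/

@[closes "route-ValiantsHypothesis-ContractivityPrice"] theorem closes (h₁ : PriceOfContractivity) (h₂ : ContractiveHardness) (h₃ : StabilisedPerZeroFree)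
    (h₄ : StabilisedPerDetRepr) (h₅ : QpComposition) : _root_.ValiantsHypothesis := by
  -- Step 1: the permanent is not a VP family (K1 + K2 + the three glue supports + BCS97 Cor. (21.40) in tree).
  have hnot : ¬ Literature.Computability.AlgebraicComplexity.IsVPFamily
      (fun n => Literature.Computability.AlgebraicComplexity.perPoly (Fin n) ℂ) := by
    intro hVP
    obtain ⟨c, hc⟩ :=
      Literature.Computability.AlgebraicComplexity.isQPBounded_determinantalComplexity_of_isVPFamily_holds _ hVP
    obtain ⟨d, hd⟩ := h₁
    obtain ⟨c', hc'⟩ := h₅ c d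
    obtain ⟨n, hn⟩ := h₂ c'
    have hrep := h₄ n _
      (Literature.Computability.AlgebraicComplexity.hasDetRepr_determinantalComplexity_holds
        (Literature.Computability.AlgebraicComplexity.perPoly (Fin n) ℂ))
    obtain ⟨R, hR, K, κ, hK, hQ⟩ := hd (n ^ 2) _ _ (by simp [sq]) hrep (h₃ n)
    exact hn R (hR.trans (hc' n _ _ (hc n) le_rfl)) _ K κ hK hQ
  -- Step 2: hub bookkeeping (per ∈ VNP, renaming bridge), as in Theorems/HubHub.lean.
  show Literature.Computability.AlgebraicComplexity.VP ℂ ≠ Literature.Computability.AlgebraicComplexity.VNP ℂ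
  intro hEq
  apply hnot
  have hper : Literature.Computability.AlgebraicComplexity.perFamily ℂ ∈
      Literature.Computability.AlgebraicComplexity.VP ℂ := by
    rw [hEq]; exact Literature.Computability.AlgebraicComplexity.perFamily_mem_VNP_holds ℂ
  exact (Literature.Computability.AlgebraicComplexity.mem_VP_ofFintype_iff_holds _).1 hper

end Summit.ValiantsHypothesis.ValiantsHypothesis.Theses.ContractivityPrice
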